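import Literature.AlgebraicGeometry.Motives.ChowProjectiveSpaceLines
import Literature.AlgebraicGeometry.Motives.ProjectiveSpaceLinearSubst
import Mathlib.LinearAlgebra.Basis.VectorSpace
import HarnessLib

/-!
# Tian–Zong Thm. 1.7 for linear subspaces: `CH₁` of `X ≅ ℙⁿ ⊆ ℙⁿ⁺ᶜ` is generated by lines

The named fact `TianZong2014_chowOne_generatedByLines` (`Motives/LinesGenerateChowOne`; Tian–Zong,
*One-cycles on rationally connected varieties*, Compositio Math. 150 (2014), Thm. 1.7) in the case
where all the defining forms are **linear** (`d₁ = ⋯ = d_c = 1`): then `X ⊆ ℙⁿ⁺ᶜ` is a linear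
subspace `≅ ℙⁿ`, and `CH₁(ℙⁿ) = ℤ · [line]` (`Motives/ChowProjectiveSpaceLines`, Fulton Example
1.9.3). The reduction to the coordinate subspace `V₊(x_{n+1}, …, x_{n+c})` is a projective linear
change of coordinates (`Motives/ProjectiveSpaceLinearSubst.substMap`, Hartshorne II 7.1.1) built
from a basis of the linear forms extending `F₁, …, F_c` (Mathlib `Basis.sumExtend`).

* `lin v = Σ vⱼ xⱼ` and its algebra; `exists_basis_extending`, `exists_linearSubst` — an
  invertible linear substitution `τ` with `τ_{n+1+a} = F_a`.
* `isIso_substMapHom` — `substMap` of an invertible substitution is an automorphism of `ℙᴺ`;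
  `substMapHom_preimage_zeroLocus` — it pulls `V₊(S)` back to `V₊(σ_τ S)`.
* `chowOneGeneratedByLines_of_linear` — **for `X` smooth projective of dimension `n ≥ 1` embedded
  by a closed immersion `i` onto `V₊(F₁, …, F_c) ⊆ ℙⁿ⁺ᶜ` with `F` linear and nonsingular
  (Jacobian criterion), `CH₁(X)` is generated by lines** (`ChowOneGeneratedByLines (n + c) i`);
  `TianZong2014_chowOne_generatedByLines_of_forall_eq_one` — the named fact's statement with the
  extra hypothesis `∀ a, d a = 1`.

Everything is proved; no named facts.

## References

* [TianZong2014] Z. Tian, H. R. Zong, *One-cycles on rationally connected varieties*, Compositio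
  Math. 150 (2014), Thm. 1.7.
* W. Fulton, *Intersection Theory*, Example 1.9.3. [Fulton1998]
* R. Hartshorne, *Algebraic Geometry*, II Example 7.1.1, I Ex. 2.11. [Hartshorne1977]
-/

noncomputable section

open CategoryTheory AlgebraicGeometry Order TopologicalSpace

universe u

namespace Literature.AlgebraicGeometry.Motives

namespace ProjectiveSpaceCells

/-! ### Linear forms as coefficient vectors -/

section LinearAlgebra

open _root_.MvPolynomial

variable {k : Type u} [Field k] {N : ℕ}

/-- The linear form `Σⱼ vⱼ xⱼ` with coefficient vector `v`. [folklore] -/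
def lin (v : Fin (N + 1) → k) : MvPolynomial (Fin (N + 1)) k := ∑ j, v j • MvPolynomial.X j

/-- `v ↦ Σⱼ vⱼ xⱼ` as a linear map. [folklore] -/
def linMap : (Fin (N + 1) → k) →ₗ[k] MvPolynomial (Fin (N + 1)) k where
  toFun := lin
  map_add' v w := by simp [lin, add_smul, Finset.sum_add_distrib]
  map_smul' a v := by simp [lin, Finset.smul_sum, smul_smul]

/-- `linMap v = lin v` (`rfl`). [folklore] -/
@[simp] theorem linMap_apply (v : Fin (N + 1) → k) : linMap v = lin v := rfl

/-- The coefficient of `xⱼ` in `Σ vᵢ xᵢ` is `vⱼ`. [folklore] -/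
theorem coeff_lin (v : Fin (N + 1) → k) (j : Fin (N + 1)) :
    MvPolynomial.coeff (Finsupp.single j 1) (lin v) = v j := by
  classical
  simp only [lin, MvPolynomial.coeff_sum, MvPolynomial.coeff_smul, MvPolynomial.coeff_X, smul_eq_mul,
    mul_ite, mul_one, mul_zero]
  have h : ∀ x, (if Finsupp.single x 1 = Finsupp.single j 1 then v x else 0) =
      if x = j then v x else 0 := fun x ↦ by
    by_cases hx : x = j
    · subst hx; simp
    · rw [if_neg (fun h ↦ hx (Finsupp.single_left_injective one_ne_zero h)), if_neg hx]
  simp only [h, Finset.sum_ite_eq', Finset.mem_univ, if_true]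

/-- `lin` is injective. [folklore] -/
theorem lin_injective : Function.Injective (lin (k := k) (N := N)) := fun v w h ↦
  funext fun j ↦ by rw [← coeff_lin v j, ← coeff_lin w j, h]

/-- `ker linMap = 0`. [folklore] -/
theorem ker_linMap : LinearMap.ker (linMap (k := k) (N := N)) = ⊥ :=
  LinearMap.ker_eq_bot.mpr lin_injective

/-- `Σ vⱼ xⱼ` is a linear form. [folklore] -/
theorem isHomogeneous_lin (v : Fin (N + 1) → k) : (lin v).IsHomogeneous 1 := by
  unfold lin
  refine MvPolynomial.IsHomogeneous.sum _ _ _ fun j _ ↦ ?_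
  rw [MvPolynomial.smul_eq_C_mul]
  simpa using (MvPolynomial.isHomogeneous_C _ (v j)).mul (MvPolynomial.isHomogeneous_X k j)

/-- `lin eⱼ = xⱼ`. [folklore] -/
theorem lin_pi_single (j : Fin (N + 1)) : lin (Pi.single j 1 : Fin (N + 1) → k) = MvPolynomial.X j := by
  classical
  unfold lin
  rw [Finset.sum_eq_single j]
  · simp
  · intro i _ hij
    simp [hij]
  · simp

/-- A linear form is the sum of its coefficients times the variables (a private copy of the
lemma of `Motives/LinesGenerateChowOneProofs`). [folklore] -/
private theorem sum_coeff_single_smul_X_of_isHomogeneous_one' {f : MvPolynomial (Fin (N + 1)) k}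
    (hf : f.IsHomogeneous 1) :
    ∑ p, MvPolynomial.coeff (Finsupp.single p 1) f • (MvPolynomial.X p : MvPolynomial (Fin (N + 1)) k) =
      f := by
  classical
  ext d
  simp only [MvPolynomial.coeff_sum, MvPolynomial.coeff_smul, MvPolynomial.coeff_X, smul_eq_mul,
    mul_ite, mul_one, mul_zero]
  by_cases hd : ∃ p, Finsupp.single p 1 = d
  · obtain ⟨p, rfl⟩ := hd
    rw [Finset.sum_eq_single p (fun q _ hq => if_neg fun h =>
      hq (Finsupp.single_left_injective one_ne_zero h)) (fun h => absurd (Finset.mem_univ p) h),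
      if_pos rfl]
  · rw [Finset.sum_eq_zero fun p _ => if_neg fun h => hd ⟨p, h⟩]
    refine (hf.coeff_eq_zero fun hdeg => hd ?_).symm
    obtain ⟨p, hp⟩ := (Finsupp.sum_eq_one_iff d).mp hdeg
    exact ⟨p, hp.symm⟩

/-- A linear form is `Σⱼ (coefficient of xⱼ) xⱼ`. [folklore] -/
theorem eq_lin_of_isHomogeneous_one {f : MvPolynomial (Fin (N + 1)) k} (hf : f.IsHomogeneous 1) :
    f = lin (fun j ↦ MvPolynomial.coeff (Finsupp.single j 1) f) :=
  (sum_coeff_single_smul_X_of_isHomogeneous_one' hf).symm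

/-- Substituting `xⱼ ↦ τⱼ` in `Σ vⱼ xⱼ` gives `Σ vⱼ τⱼ`. [folklore] -/
theorem aeval_lin {S : Type*} [CommRing S] [Algebra k S] (τ : Fin (N + 1) → S)
    (v : Fin (N + 1) → k) : MvPolynomial.aeval τ (lin v) = ∑ j, v j • τ j := by
  simp [lin, map_sum]

/-- **Extending independent vectors to a basis with prescribed positions**: `c` linearly
independent vectors `w₁, …, w_c` of `k^{N+1}`, `N + 1 = m + c`, are the last `c` vectors of a
basis indexed by `Fin (N + 1)` (Mathlib `Basis.sumExtend`, reindexed). [folklore] -/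
theorem exists_basis_extending {c m : ℕ} (w : Fin c → (Fin (N + 1) → k))
    (hw : LinearIndependent k w) (h : N + 1 = m + c) :
    ∃ b : Module.Basis (Fin (N + 1)) k (Fin (N + 1) → k), ∀ a : Fin c, b ⟨m + a, by omega⟩ = w a := by
  classical
  let B := Module.Basis.sumExtend hw
  haveI : Finite (Fin c ⊕ Module.Basis.sumExtendIndex hw) := Module.Finite.finite_basis (R := k) (M := Fin (N + 1) → k) B
  haveI : Finite (Module.Basis.sumExtendIndex hw) :=
    Finite.of_injective (Sum.inr : _ → Fin c ⊕ Module.Basis.sumExtendIndex hw) Sum.inr_injective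
  haveI : Fintype (Module.Basis.sumExtendIndex hw) := Fintype.ofFinite _
  have hcard : Fintype.card (Module.Basis.sumExtendIndex hw) = m := by
    have h1 := Module.finrank_eq_card_basis B
    rw [Module.finrank_fin_fun, Fintype.card_sum, Fintype.card_fin] at h1
    omega
  let eJ : Module.Basis.sumExtendIndex hw ≃ Fin m := Fintype.equivFinOfCardEq hcard
  let E : (Fin c ⊕ Module.Basis.sumExtendIndex hw) ≃ Fin (N + 1) :=
    ((Equiv.sumCongr (Equiv.refl _) eJ).trans (Equiv.sumComm _ _)).trans
      (finSumFinEquiv.trans (finCongr h.symm))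
  refine ⟨B.reindex E, fun a ↦ ?_⟩
  rw [Module.Basis.reindex_apply]
  have hE : E.symm ⟨m + a, by omega⟩ = Sum.inl a := by
    rw [Equiv.symm_apply_eq]
    simp only [E, Equiv.trans_apply, Equiv.sumCongr_apply, Sum.map_inl, Equiv.refl_apply,
      Equiv.sumComm_apply, Sum.swap_inl, finSumFinEquiv_apply_right, finCongr_apply]
    exact Fin.ext (by simp)
  rw [hE]
  -- `sumExtend hw (inl a) = w a`
  simp only [B, Module.Basis.sumExtend, Module.Basis.reindex_apply, Equiv.symm_symm]
  erw [Module.Basis.extend_apply_self]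
  dsimp only [Trans.trans]
  erw [Equiv.trans_apply, Equiv.sumCongr_apply, Sum.map_inl, Equiv.Set.sumDiffSubset_apply_inl,
    Set.coe_inclusion, Equiv.ofInjective_apply]

/-- **The invertible linear substitution attached to a basis of `k^{N+1}`.** For a basis `b` the
linear forms `τⱼ = Σₗ (bⱼ)ₗ xₗ` are linearly independent, and the substitution `xⱼ ↦ τⱼ` has the
inverse substitution `τ'ⱼ = Σₗ (coordinates of eⱼ in b)ₗ xₗ`: `σ_τ ∘ σ_{τ'} = id = σ_{τ'} ∘ σ_τ`.
[folklore] -/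
theorem exists_linearSubst_of_basis (b : Module.Basis (Fin (N + 1)) k (Fin (N + 1) → k)) :
    ∃ τ' : Fin (N + 1) → MvPolynomial (Fin (N + 1)) k,
      (∀ j, (lin (b j)).IsHomogeneous 1) ∧ (∀ j, (τ' j).IsHomogeneous 1) ∧
        (∀ p, MvPolynomial.aeval (fun j ↦ lin (b j)) (MvPolynomial.aeval τ' p) = p) ∧
          (∀ p, MvPolynomial.aeval τ' (MvPolynomial.aeval (fun j ↦ lin (b j)) p) = p) ∧
            LinearIndependent k (fun j ↦ lin (b j)) := by
  classical
  refine ⟨fun j ↦ lin (fun i ↦ b.repr (Pi.single j 1) i),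
    fun j ↦ isHomogeneous_lin _, fun j ↦ isHomogeneous_lin _, ?_, ?_, ?_⟩
  · -- `σ_τ (τ'ⱼ) = Σᵢ (repr eⱼ)ᵢ τᵢ = lin (Σᵢ (repr eⱼ)ᵢ bᵢ) = lin eⱼ = xⱼ`
    intro p
    have h : (MvPolynomial.aeval fun j ↦ lin (b j)).comp
        (MvPolynomial.aeval fun j ↦ lin (fun i ↦ b.repr (Pi.single j 1) i)) = AlgHom.id k _ := by
      refine MvPolynomial.algHom_ext fun j ↦ ?_
      simp only [AlgHom.coe_comp, Function.comp_apply, MvPolynomial.aeval_X, AlgHom.coe_id, id_eq]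
      rw [aeval_lin]
      have hsum : ∑ i, (b.repr (Pi.single j 1)) i • lin (b i) =
          lin (∑ i, (b.repr (Pi.single j 1)) i • b i) := by
        rw [← linMap_apply, map_sum]; simp only [map_smul, linMap_apply]
      rw [hsum, b.sum_repr, lin_pi_single]
    exact congr($h p)
  · -- `σ_{τ'} (τⱼ) = Σᵢ (bⱼ)ᵢ τ'ᵢ = lin (repr (Σᵢ (bⱼ)ᵢ eᵢ)) = lin (repr bⱼ) = xⱼ`
    intro p
    have h : (MvPolynomial.aeval fun j ↦ lin (fun i ↦ b.repr (Pi.single j 1) i)).comp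
        (MvPolynomial.aeval fun j ↦ lin (b j)) = AlgHom.id k _ := by
      refine MvPolynomial.algHom_ext fun j ↦ ?_
      simp only [AlgHom.coe_comp, Function.comp_apply, MvPolynomial.aeval_X, AlgHom.coe_id, id_eq]
      rw [aeval_lin]
      have hsum : ∑ i, b j i • lin (fun l ↦ b.repr (Pi.single i 1) l) =
          lin (fun l ↦ b.repr (∑ i, b j i • (Pi.single i 1 : Fin (N + 1) → k)) l) := by
        have h1 : ∀ i, b j i • lin (fun l ↦ b.repr (Pi.single i 1) l) =
            lin (b j i • fun l ↦ b.repr (Pi.single i 1) l) := fun i ↦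
          (linMap.map_smul (b j i) _).symm
        simp only [h1]
        rw [show ∑ i, lin (b j i • fun l ↦ b.repr (Pi.single i 1) l) =
          lin (∑ i, b j i • fun l ↦ b.repr (Pi.single i 1) l) from (map_sum linMap _ _).symm]
        congr 1
        ext l
        simp [Finset.sum_apply, Pi.smul_apply, map_sum, map_smul]
      have hbj : ∑ i, b j i • (Pi.single i 1 : Fin (N + 1) → k) = b j := by
        ext l; simp [Finset.sum_apply, Pi.single_apply]
      rw [hsum, hbj, b.repr_self]
      have : (fun l ↦ (Finsupp.single j (1 : k)) l) = (Pi.single j 1 : Fin (N + 1) → k) := by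
        ext l; simp [Finsupp.single_apply, Pi.single_apply, eq_comm]
      rw [this, lin_pi_single]
    exact congr($h p)
  · exact b.linearIndependent.map' linMap ker_linMap

/-- **An invertible linear substitution sending the last `c` variables to given independent linear
forms.** For linearly independent linear forms `F₁, …, F_c` on `ℙⁿ⁺ᶜ` there are linear forms
`τ₀, …, τ_{n+c}` forming a basis, with `τ_{n+1+a} = F_a`, and an inverse substitution `τ'`
(`σ_τ ∘ σ_{τ'} = id = σ_{τ'} ∘ σ_τ` on `k[x₀, …, x_{n+c}]`). [folklore] -/
theorem exists_linearSubst {c n : ℕ} (F : Fin c → MvPolynomial (Fin (n + c + 1)) k)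
    (hF : ∀ a, (F a).IsHomogeneous 1) (hli : LinearIndependent k F) :
    ∃ τ τ' : Fin (n + c + 1) → MvPolynomial (Fin (n + c + 1)) k,
      (∀ j, (τ j).IsHomogeneous 1) ∧ (∀ j, (τ' j).IsHomogeneous 1) ∧
        (∀ p, MvPolynomial.aeval τ (MvPolynomial.aeval τ' p) = p) ∧
          (∀ p, MvPolynomial.aeval τ' (MvPolynomial.aeval τ p) = p) ∧
          (∀ a : Fin c, τ ⟨n + 1 + a, by omega⟩ = F a) ∧ LinearIndependent k τ := by
  classical
  -- coefficient vectors of the `F a`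
  let w : Fin c → (Fin (n + c + 1) → k) := fun a j ↦ MvPolynomial.coeff (Finsupp.single j 1) (F a)
  have hwF : ∀ a, lin (w a) = F a := fun a ↦ (eq_lin_of_isHomogeneous_one (hF a)).symm
  have hw : LinearIndependent k w := by
    refine LinearIndependent.of_comp linMap ?_
    have : ⇑linMap ∘ w = F := funext fun a ↦ hwF a
    rw [this]; exact hli
  obtain ⟨b, hb⟩ := exists_basis_extending w hw (m := n + 1) (by omega)
  obtain ⟨τ', hτ, hτ', hinv, hinv', hτli⟩ := exists_linearSubst_of_basis b
  refine ⟨fun j ↦ lin (b j), τ', hτ, hτ', hinv, hinv', fun a ↦ ?_, hτli⟩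
  change lin (b ⟨n + 1 + a, _⟩) = F a
  rw [hb a, hwF a]

end LinearAlgebra

/-! ### Projective linear transformations are automorphisms; their action on zero loci -/

section Subst

open _root_.MvPolynomial

variable {k : Type u} [Field k] {n : ℕ}

attribute [local instance] MvPolynomial.gradedAlgebra ProjBaseChange.algebraBase

local notation "𝓐" => MvPolynomial.homogeneousSubmodule (Fin (n + 1)) k

variable (τ : Fin (n + 1) → MvPolynomial (Fin (n + 1)) k) (hτ : ∀ j, (τ j).IsHomogeneous 1)
  (τ' : Fin (n + 1) → MvPolynomial (Fin (n + 1)) k) (hτ' : ∀ j, (τ' j).IsHomogeneous 1)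
  (hinv : ∀ p, MvPolynomial.aeval τ (MvPolynomial.aeval τ' p) = p) (hinv' : ∀ p, MvPolynomial.aeval τ' (MvPolynomial.aeval τ p) = p)

/-- `Proj.map` only depends on the graded homomorphism (congruence for rewriting). [folklore] -/
theorem projMap_congr {A : Type*} [CommRing A] [Algebra k A] {𝒜 : ℕ → Submodule k A}
    [GradedAlgebra 𝒜] {f g : 𝒜 →+*ᵍ 𝒜} (h : f = g)
    (hf : HomogeneousIdeal.irrelevant 𝒜 ≤ (HomogeneousIdeal.irrelevant 𝒜).map f) :
    Proj.map f hf = Proj.map g (h ▸ hf) := by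
  subst h; rfl

include hinv in
/-- `σ_τ ∘ σ_{τ'} = id` as graded ring homomorphisms. [folklore] -/
theorem substGraded_comp :
    (ProjectiveSpace.substGraded τ hτ).comp (ProjectiveSpace.substGraded τ' hτ') = GradedRingHom.id 𝓐 := by
  ext p : 1
  exact hinv p

include hinv' in
/-- **`substMap τ ≫ substMap τ' = 𝟙`** (Mathlib `Proj.map_comp`, `Proj.map_id`). [folklore] -/
theorem substMapHom_comp_substMapHom :
    ProjectiveSpace.substMapHom τ hτ τ' hτ' hinv ≫ ProjectiveSpace.substMapHom τ' hτ' τ hτ hinv' =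
      𝟙 (Proj 𝓐) := by
  rw [ProjectiveSpace.substMapHom_eq, ProjectiveSpace.substMapHom_eq, ← Proj.map_comp,
    projMap_congr (substGraded_comp τ hτ τ' hτ' hinv)]
  exact Proj.map_id

include hinv' in
/-- **A projective linear transformation with an inverse substitution is an automorphism of `ℙⁿ`.**
[cite: Hartshorne1977, II Example 7.1.1] -/
theorem isIso_substMapHom : IsIso (ProjectiveSpace.substMapHom τ hτ τ' hτ' hinv) :=
  ⟨ProjectiveSpace.substMapHom τ' hτ' τ hτ hinv', substMapHom_comp_substMapHom τ hτ τ' hτ' hinv hinv',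
    substMapHom_comp_substMapHom τ' hτ' τ hτ hinv' hinv⟩

/-- **`substMap τ` pulls `V₊(S)` back to `V₊(σ_τ S)`** (on points `Proj.map` is `𝔭 ↦ σ_τ⁻¹ 𝔭`).
[folklore] -/
theorem substMapHom_preimage_zeroLocus (S : Set (MvPolynomial (Fin (n + 1)) k)) :
    (ProjectiveSpace.substMapHom τ hτ τ' hτ' hinv).base ⁻¹' ProjectiveSpectrum.zeroLocus 𝓐 S =
      ProjectiveSpectrum.zeroLocus 𝓐 (MvPolynomial.aeval τ '' S) := by
  ext p
  change S ⊆ MvPolynomial.aeval τ ⁻¹' ((p : ProjectiveSpectrum 𝓐).asHomogeneousIdeal : Set _) ↔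
    MvPolynomial.aeval τ '' S ⊆ ((p : ProjectiveSpectrum 𝓐).asHomogeneousIdeal : Set _)
  exact Set.image_subset_iff.symm

end Subst

/-! ### The linear case of Tian–Zong's theorem -/

section LinearCase

open _root_.MvPolynomial

variable {k : Type u} [Field k]

attribute [local instance] MvPolynomial.gradedAlgebra ProjBaseChange.algebraBase

/-- **`CH₁` of a linear subspace is generated by lines.** Let `X` be a smooth projective `k`-variety
of dimension `n ≥ 1` and `i : X ⟶ ℙⁿ⁺ᶜ_k` a closed `k`-immersion whose image is `V₊(F₁, …, F_c)` for
linear forms `F` satisfying the Jacobian criterion (so `X` is an `n`-plane). Then every `1`-cycle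
on `X` is rationally equivalent to an integral combination of lines of `X`: after a projective
linear change of coordinates `X` maps isomorphically onto the coordinate subspace
`Λₙ = V₊(x_{n+1}, …, x_{n+c})`, where `CH₁ = ℤ·[line]` (`Motives/ChowProjectiveSpaceLines`).
[cite: TianZong2014, Thm. 1.7 (linear case)] [cite: Fulton1998, Example 1.9.3] -/
theorem chowOneGeneratedByLines_of_linear {c : ℕ} (n : ℕ) (hn : 1 ≤ n) {X : SchemeOver k}
    (F : Fin c → MvPolynomial (Fin (n + c + 1)) k) (i : X ⟶ projectiveSpace (n + c) k)
    (hX : IsSmoothProjective n X) (hF : ∀ a, (F a).IsHomogeneous 1) (hJ : IsNonsingularSystem k F)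
    (hi : IsClosedImmersion i.left)
    (hV : Set.range i.left.base =
      ProjectiveSpectrum.zeroLocus (MvPolynomial.homogeneousSubmodule (Fin (n + c + 1)) k)
        (Set.range F)) :
    ChowOneGeneratedByLines (n + c) i := by
  classical
  haveI : CompactSpace ↥X.left := IsSmoothProjective.compactSpace_holds hX
  haveI : IsIntegral X.left := IsSmoothProjective.isIntegral_holds hX
  -- the change of coordinates
  have hli : LinearIndependent k F :=
    linearIndependent_of_isNonsingularSystem_of_isHomogeneous_one hF hJ (by simp)
  obtain ⟨τ, τ', hτ, hτ', hinv, hinv', hτF, hτli⟩ := exists_linearSubst F hF hli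
  let σ := ProjectiveSpace.substMapHom τ hτ τ' hτ' hinv
  haveI : IsIso σ := isIso_substMapHom τ hτ τ' hτ' hinv hinv'
  let i' : X.left ⟶ Proj (MvPolynomial.homogeneousSubmodule (Fin (n + c + 1)) k) := i.left
  haveI : IsClosedImmersion i' := hi
  let e := i' ≫ σ
  -- `σ⁻¹ Λₙ = V₊(F) = i(X)`, so `e(X) = Λₙ`
  have hpre : σ.base ⁻¹' coordSubspace k (n + c) n = Set.range i'.base := by
    change σ.base ⁻¹' ProjectiveSpectrum.zeroLocus _ _ = Set.range i.left.base
    rw [substMapHom_preimage_zeroLocus, hV]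
    congr 1
    ext f
    simp only [Set.mem_image, Set.mem_setOf_eq, Set.mem_range, exists_exists_and_eq_and, MvPolynomial.aeval_X]
    constructor
    · rintro ⟨j, hj, rfl⟩
      refine ⟨⟨j - (n + 1), by omega⟩, ?_⟩
      rw [← hτF]
      congr 1
      exact Fin.ext (by simp; omega)
    · rintro ⟨a, rfl⟩
      exact ⟨⟨n + 1 + a, by omega⟩, by simp; omega, hτF a⟩
  have hrange : Set.range e.base = coordSubspace k (n + c) n := by
    rw [Scheme.Hom.comp_base, TopCat.coe_comp, Set.range_comp, ← hpre]
    exact Set.image_preimage_eq _ σ.homeomorph.surjective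
  -- `CH₁` along the coordinate flag, applied to `e : X ↪ ℙⁿ⁺ᶜ` onto `Λₙ`
  obtain ⟨m, rfl⟩ : ∃ m, n = m + 1 := ⟨n - 1, by omega⟩
  refine (chowOneGeneratedByLines_iff_forall_primeCycle (N := m + 1 + c) (i := i)).mpr
    fun z hz ↦ ?_
  obtain ⟨y, a, hy, hrat⟩ := exists_isRationallyEquivalent_zsmul_of_range_eq_coordSubspace k 1 m
    (by omega) e hrange (primeCycle z) (primeCycle_mem_cyclesOfDim (by simpa using hz))
  refine ⟨{y}, fun _ ↦ a, fun y' hy' ↦ ?_, by simpa using hrat⟩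
  rw [Finset.mem_singleton] at hy'
  rw [hy']
  -- `y` is a line point of `X`: its image under `i` is the line `σ⁻¹(Λ₁) = V₊(σ_τ x₂, …)`
  have hidx : ∀ j : Fin (m + 1 + c - 1), 1 + 1 + (j : ℕ) < m + 1 + c + 1 := fun j ↦ by omega
  have hL : (fun j ↦ MvPolynomial.aeval τ (coordForms k (m + 1 + c) 1 j)) =
      τ ∘ fun j : Fin (m + 1 + c - 1) ↦ (⟨1 + 1 + (j : ℕ), hidx j⟩ : Fin (m + 1 + c + 1)) := by
    funext j
    simp [coordForms]
  refine ⟨?_, fun j ↦ MvPolynomial.aeval τ (coordForms k (m + 1 + c) 1 j), ?_, fun j ↦ ?_, ?_⟩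
  · rw [← height_base_eq_of_isClosedImmersion' e y, hy]
    simpa using height_coordGenericPoint k (n := m + 1 + c) (m := 1) (by omega)
  · rw [hL]
    exact hτli.comp _ fun a b hab ↦ Fin.ext (by simpa using congrArg Fin.val hab)
  · exact (isHomogeneous_coordForms k (m + 1 + c) 1 j).aeval τ hτ
  · have himg : ⇑i.left.base '' closure {y} = σ.base ⁻¹' (e.base '' closure {y}) := by
      rw [Scheme.Hom.comp_base, TopCat.coe_comp, Set.image_comp]
      exact (Set.preimage_image_eq _ σ.isClosedEmbedding.injective).symm
    rw [himg, ← e.isClosedEmbedding.closure_image_eq, Set.image_singleton, hy,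
      closure_coordGenericPoint]
    change σ.base ⁻¹' ProjectiveSpectrum.zeroLocus _ _ = _
    rw [substMapHom_preimage_zeroLocus]
    congr 1
    rw [← range_coordForms, ← Set.range_comp]
    rfl

end LinearCase

end ProjectiveSpaceCells

/-- **Tian–Zong Thm. 1.7 when all the forms are linear.** The named fact
`TianZong2014_chowOne_generatedByLines` restricted to `d₁ = ⋯ = d_c = 1`: then `X ≅ ℙⁿ` is a
linear subspace of `ℙⁿ⁺ᶜ` and `CH₁(X) = ℤ · [line]` (the degree bound forces `1 ≤ n` here, and for
`n = 0` it is contradictory). [cite: TianZong2014, Thm. 1.7 (linear case)] -/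
theorem TianZong2014_chowOne_generatedByLines_of_forall_eq_one ⦃k : Type u⦄ [Field k] ⦃c : ℕ⦄
    (n : ℕ) (d : Fin c → ℕ) ⦃X : SchemeOver k⦄ (F : Fin c → MvPolynomial (Fin (n + c + 1)) k)
    (i : X ⟶ projectiveSpace (n + c) k) (hX : IsSmoothProjective n X)
    (hF : letI := MvPolynomial.gradedAlgebra (σ := Fin (n + c + 1)) (R := k)
      ∀ a, (F a).IsHomogeneous (d a))
    (hJ : IsNonsingularSystem k F) (hi : IsClosedImmersion i.left)
    (hV : letI := MvPolynomial.gradedAlgebra (σ := Fin (n + c + 1)) (R := k)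
      Set.range i.left.base =
        ProjectiveSpectrum.zeroLocus (MvPolynomial.homogeneousSubmodule (Fin (n + c + 1)) k)
          (Set.range F))
    (hdeg : (∑ a, d a) + 1 ≤ n + c) (hd1 : ∀ a, d a = 1) :
    ChowOneGeneratedByLines (n + c) i := by
  have hF1 : ∀ a, (F a).IsHomogeneous 1 := fun a ↦ by have h := hF a; rwa [hd1 a] at h
  have hn : 1 ≤ n := by
    have : ∑ a, d a = c := by simp [hd1]
    omega
  exact ProjectiveSpaceCells.chowOneGeneratedByLines_of_linear n hn F i hX hF1 hJ hi hV

end Literature.AlgebraicGeometry.Motives
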